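import Literature.MathematicalPhysics.QuantumFieldTheory.Balaban1983to89.B9B8KnitLetterCoercive
import Literature.MathematicalPhysics.QuantumFieldTheory.Balaban1983to89.B9Thm31SiteGpDecayReg335Y

/-!
# `Balaban1983to89.B9B8KnitLetterGpDecay` — [B9] THM 3.1 AT THE KNIT LETTER, `L²` LEVEL: the operator bounds `(4(d+1)+1)⁻¹ ≤ G′(U; parKnitY) ≤ 32·L^{2k}`
# and the (3.46a)-SHAPE LOCAL DECAY `‖1_A G′(U; parKnitY) 1_B‖ ≤ 64·L^{j_A}L^{j_B}·W⁻¹` on the class (3.35) ∩ (52), by S. Agmon's positive-weight method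
# (junction J-B file 7 — the `L²` half of Thm 3.1 TRANSPORTED to print's own transporters)

statement-level skeleton of published theorems with citation tags; proofs where landed; nothing here is a claim about the
Yang–Mills mass gap

T. Bałaban, *Propagators for lattice gauge theories in a background field*, Commun. Math. Phys. **99** (1985) 389–434 [`Balaban1985BackgroundPropagators`,
"[B9]"]; T. Bałaban, *Propagators and renormalization transformations for lattice gauge theories. II*, Commun. Math. Phys. **96** (1984) 223–250
[`Balaban1984PropagatorsII`, "[4]"]; T. Bałaban, *Averaging operations for lattice gauge theories*, Commun. Math. Phys. **98** (1985) 17–51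
[`Balaban1985Averaging`, "[B7]"]; S. Agmon, *Lectures on exponential decay of solutions of second-order elliptic equations*, Princeton 1982 [`Agmon1982`].

THE PRINT.  [B9] Thm 3.1 p. 397–398, for `U` in the class (3.35): (3.42)–(3.45) and *«Finally, we have the inequalities in L₂-norms ‖hG′(U)λ‖, … ≤
B₀(Lʲη)(Lʲ′η)e^{−δ₀d(y,y′)}‖h‖‖λ‖ for supp h ⊂ Δ̃(y), y ∈ Λ_j, supp λ ⊂ Δ̃(y′)»* (3.46), where `G′(U) = (Δ′_a(U))⁻¹` ((3.25) p. 394) and the averaging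
operators in `Δ′_a(U)` ((3.24) p. 394, (3.19) p. 393) carry the composite-contour transporters *«defined by (52), (53) in [5]»* — print's letter IS the knit
letter `parKnitY` of the junction (J-B files 1–2), NOT def-Y's taxicab letter of record `parSymY` at which dag-w1's site-coercivity set proved the `L²`
theory (`B9Thm31SiteGpBoundsReg335Y`, `B9Thm31SiteGpDecayReg335Y`).

WHY THIS FILE ∕ THE ARGUMENT.  J-B file 6 (`B9B8KnitLetterCoercive`, p599808) transferred the LEVEL-WEIGHTED coercivity to the knit letter:
`(1∕32)·Σ_z (L^{j(z)})⁻²·HS(Φ z) ≤ Re⟨Φ, Δ′_a(U; parKnitY)Φ⟩` on `Reg335 c α₀ ∩ {pdev (liftCfg U) < α₀′L^{−2k}}`.  dag-w1's conjugation bound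
`B9Thm31SiteConjugatedFormY.trIP_wsmul_deltaPrimeAY_winv_ge` and Lax–Milgram bookkeeping `B9Thm31SiteGpBoundsReg335Y` §2 are GENERIC in the
transporter table, and Agmon's two readings (`B9Thm31SiteGpDecayReg335Y` §2) only use the coercivity constant: so the whole `L²` half of Thm 3.1 passes
to the knit letter with `1∕8 ↦ 1∕32` (operator norm `8L^{2k} ↦ 32L^{2k}`, Agmon floor `1∕16 ↦ 1∕64`, decay prefactor `256 ↦ 4096`).

CITATION HEADER (lean-in-tree rule).  Cell `lit-balaban`, sub-row G-B9-LETTERS, junction J-B (lead RULINGS #3–#4; RULING #4 (ii) «the (E12)-type bounds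
from Thm 3.1 at the knit letter») file 7 → seat `lit-balaban-p33` gen 94.  REUSED BY NAME: file 6's ★ `trIP_deltaPrimeAY_parKnitY_ge_levelMass` ∕
`trIP_deltaPrimeAY_parKnitY_ge`; dag-w1's `trIP_wsmul_deltaPrimeAY_winv_ge`, `trIP_deltaPrimeAY_le`, `trIP_ringInverse_self_le ∕ _le ∕ _ge_self`,
`trIP_self_le_ringInverse_of_symm`, `trIP_wsq_eq_of_support`, `abs_trIP_le_of_support`, `sum_filter_hs_le_levelMass`, `agmon_arith_pairing`,
`agmon_arith`; dag-n06-j's `deltaPrimeAY_isSymmTr_of_inv_symm`; junction files 1∕3∕4b (`parKnitY_inv`, `isUnit_deltaPrimeAY_parKnitY`,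
`deltaPrimeAY_parKnitY_posDefTr`, `parKnitY_mem_of_pdev`).

WHAT THIS FILE PROVES (sorry-free; no definitions; nothing of [B9] asserted beyond what is proved).  Hypotheses «ON THE CLASS» = `G ≤ U(N)`
averaging-closed, `N ≥ 1`, `U ∈ (bg9K (M_N ℂ) G i).Reg335 c α₀` with `0 ≤ cMα₀`, `cMα₀(d+1) ≤ 1∕16`, and `pdev (liftCfg U) < α₀′(L^k)⁻²` with `0 < α₀′`,
`C₀α₀′ ≤ ⅓`, `2α₀′ ≤ c₂′`, `(d+1)²α₀′ ≤ 1∕100` (file 6's letters).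
* §1 ★★ `trIP_wsmul_deltaPrimeAY_parKnitY_winv_ge_levelMass` — ON THE CLASS, for a weight `ω > 0` with bond ratios `q ≤ θ_b·(L^{lev})⁻²` and block
  oscillation `q ≤ θ_s`: `(1∕32 − ((d+1)θ_b + θ_s∕2))·Σ_z (L^{lev z})⁻²HS(Φ z) ≤ ⟨ωΦ, Δ′_a(U; parKnitY)(ω⁻¹Φ)⟩₁`.
* §2 `symm0_parKnitY`, `trIP_deltaPrimeAY_parKnitY_le` (`⟨Φ, Δ′_knitΦ⟩ ≤ (4(d+1)+1)‖Φ‖²`, no smallness), ★★ `trIP_GpY_parKnitY_self_le`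
  (`‖G′Ψ‖² ≤ (32L^{2k})²‖Ψ‖²`), ★★ `trIP_GpY_parKnitY_le` (`⟨Ψ, G′Ψ⟩ ≤ 32L^{2k}‖Ψ‖²`), `trIP_GpY_parKnitY_ge_self`, `levelMass_GpY_parKnitY_le`,
  ★ `trIP_self_le_GpY_parKnitY` (`‖Ψ‖² ≤ (4(d+1)+1)⟨Ψ, G′Ψ⟩`, no smallness) — `(4(d+1)+1)⁻¹ ≤ G′(U; parKnitY) ≤ 32L^{2k}` as forms.
* §3 `agmon_unpack_of_le` (the constants with a free floor), `conj_wsmul_GpY_parKnitY_eq_pairing`, ★★ `levelMass_wsmul_GpY_parKnitY_le_pairing`,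
  ★★ `pairing_GpY_parKnitY_le_of_support`, ★★★ **`hs_restrict_GpY_parKnitY_le`**: ON THE CLASS, finite site sets `A, B`, `Ψ` vanishing off `B`, a weight
  `ω > 0` with `ω = 1` on `B`, `ω ≥ W > 0` on `A`, the bond∕block hypotheses with `(d+1)θ_b + θ_s∕2 ≤ 1∕64`, levels `≤ j_A` on `A`, `≤ j_B` on `B`:
  `Σ_{z∈A}HS((G′(U; parKnitY)Ψ)(z)) ≤ 4096·((L^{j_A})²(L^{j_B})²∕W²)·‖Ψ‖²₁` — print's `B₀(Lʲη)(Lʲ′η)e^{−δ₀d(y,y′)}` with `B₀ = 64` once `W = e^{δ₀d}`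
  (dag-w1's `B9Thm31SiteAgmonWeightY` supplies such weights, letter-free).

HONEST SCOPE.  The `L²` statements of Thm 3.1 for ONE finite lattice operator at a time, constants explicit and uniform in the member, the volume, `k`, `N`,
`U`; the sup-norm ∕ Hölder inequalities (3.42)–(3.45) at the knit letter are NOT proved here (junction files 8–9 transfer (3.42)₁ from def-Y's letter);
the (52) hypothesis on the lift is carried explicitly (file 4b's header).  Count-neutral; nothing continuum, nothing about OS axioms or the mass gap.
No `sorry`, no `axiom`, no `instance`, no `notation`.  NEW file; nothing landed is modified.  Net new unproved facts: 0.  Seat `lit-balaban-p33` gen 94, 2026-08-28.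
-/

noncomputable section

namespace Literature.MathematicalPhysics.QuantumFieldTheory.Balaban1983to89.B9B8KnitLetterGpDecay

open Node00 B6KLevelCensusIndexV1 B6Geom246MultiLevelBox B6MultiLevelBoxOperator B6MultiLevelTorusOperator B6GlobalChartV1 B9BackgroundsKLevelV1
  B9Eq39Adjoint B9Thm311ReadingCoords B9Thm311DeltaPrimePos B9Ineq369CurvatureSmallAtLettersY B9Thm31SiteCoerciveGaugeBlockY
  B9Thm31SiteCoerciveReg335Y B9Thm31SiteGpBoundsReg335Y B9Thm31SitePolarisedFormY B9Thm31SiteConjugatedFormY B9Thm31SiteGpDecayReg335Y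
open Literature.MathematicalPhysics.QuantumFieldTheory.Balaban1983to89.B9Ineq349SiteAdjoint (trIP_comm)
open Literature.MathematicalPhysics.QuantumFieldTheory.Balaban1983to89.B9Thm311DeltaPrimeSymm (trIP_one_eq deltaPrimeAY_isSymmTr_of_inv_symm)
open Literature.MathematicalPhysics.QuantumFieldTheory.Balaban1983to89.B9Thm311FlippedBondLetters (hs_real_smul)
open B7Prop2Explicit (AvgClosed pdev C0 c2')
open B9B8CarrierDictionary (liftCfg)
open B9B8AveragingJunction (parKnitY parKnitY_inv)
open B9B8KnitLetterRegular (parKnitY_mem_of_pdev)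
open B9Thm311PositivityKnitLetter (isUnit_deltaPrimeAY_parKnitY deltaPrimeAY_parKnitY_posDefTr)
open B9B8KnitLetterCoercive (trIP_deltaPrimeAY_parKnitY_ge_levelMass trIP_deltaPrimeAY_parKnitY_ge)
open scoped Matrix Matrix.Norms.L2Operator

variable {d ℓ : ℕ} {hd : 1 ≤ d + 1} {hL : Odd (ℓ + 1) ∧ 1 < ℓ + 1} {b₀ b₁ : ℝ}
variable (i : KIdx d ℓ hd hL b₀ b₁) {N : ℕ} {G : Subgroup (Matrix (Fin N) (Fin N) ℂ)ˣ}

/-! ## §1 The conjugated coercivity at the knit letter -/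

/-- ★★ **THE CONJUGATED COERCIVITY OF `Δ′_a(U; parKnitY)` ON THE CLASS (3.35) ∩ (52)**: for a weight `ω > 0` with bond ratios `q ≤ θ_b·(L^{lev})⁻²`
(both ends) and block oscillation `q ≤ θ_s`:  `(1∕32 − ((d+1)θ_b + θ_s∕2))·Σ_z (L^{lev z})⁻²·HS(Φ z) ≤ ⟨ωΦ, Δ′_a(U; parKnitY)(ω⁻¹Φ)⟩₁`.
[cite: Agmon1982, Ch.1, Thm 1.5; Balaban1985BackgroundPropagators, Thm 3.1 p.397, (3.24) p.394, (3.19) p.393, (3.35) p.396; Balaban1985Averaging, (52)–(53) pp.26–27] -/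
theorem trIP_wsmul_deltaPrimeAY_parKnitY_winv_ge_levelMass [Nonempty (Fin N)] (hG : G ≤ B7Prop2Explicit.unitaryUnits (Matrix (Fin N) (Fin N) ℂ))
    (hGa : AvgClosed (d + 1) (ℓ + 1) G) {U : CfgY (Matrix (Fin N) (Fin N) ℂ) i} {c α₀ : ℝ} (hC0 : 0 ≤ c * (kGeo i).M * α₀)
    (hC1 : c * (kGeo i).M * α₀ * ((d : ℝ) + 1) ≤ 1 / 16) (hreg : (bg9K (Matrix (Fin N) (Fin N) ℂ) G i).Reg335 c α₀ U)
    {α₀' : ℝ} (hα : 0 < α₀') (hα3 : C0 (d + 1) * α₀' ≤ 1 / 3) (hα2 : 2 * α₀' ≤ c2' (d + 1) (ℓ + 1)) (hαd : ((d : ℝ) + 1) ^ 2 * α₀' ≤ 1 / 100)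
    (h52 : pdev (liftCfg U) < α₀' * ((((ℓ + 1 : ℕ) : ℝ) ^ i.k)⁻¹) ^ 2) {ω : SiteY i → ℝ} (hω : ∀ z, 0 < ω z) {θb θs : ℝ}
    (hb1 : ∀ μ z, ω (shiftY i μ z) / ω z + ω z / ω (shiftY i μ z) - 2 ≤ θb * (((((ℓ + 1) ^ (blkOf i.D.toDomains z).1.1 : ℕ) : ℝ)) ^ 2)⁻¹)
    (hb2 : ∀ μ z, ω (shiftY i μ z) / ω z + ω z / ω (shiftY i μ z) - 2 ≤ θb * (((((ℓ + 1) ^ (blkOf i.D.toDomains (shiftY i μ z)).1.1 : ℕ) : ℝ)) ^ 2)⁻¹)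
    (hs : ∀ z w : SiteY i, blkOf i.D.toDomains w = blkOf i.D.toDomains z → ω z / ω w + ω w / ω z - 2 ≤ θs)
    (Φ : SiteY i → Matrix (Fin N) (Fin N) ℂ) :
    (1 / 32 - (((d : ℝ) + 1) * θb + θs / 2)) * ∑ z : SiteY i, (((((ℓ + 1) ^ (blkOf i.D.toDomains z).1.1 : ℕ) : ℝ)) ^ 2)⁻¹ * ∑ a, ∑ b, ‖Φ z a b‖ ^ 2
      ≤ trIP (fun _ => (1 : ℝ)) (fun z => ((ω z : ℝ) : ℂ) • Φ z) (deltaPrimeAY i (parKnitY i) U (fun z => (((ω z)⁻¹ : ℝ) : ℂ) • Φ z)) := by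
  have hU : ∀ μ x, U μ x ∈ G := hreg.1
  have hparK : ∀ z w : SiteY i, parKnitY i U z w ∈ G := fun z w => parKnitY_mem_of_pdev i hGa hU hα hα3 hα2 h52 z w
  have h1 := trIP_deltaPrimeAY_parKnitY_ge_levelMass i hG hGa hC0 hC1 hreg hα hα3 hα2 hαd h52 Φ
  have h2 := trIP_wsmul_deltaPrimeAY_winv_ge i hG (parKnitY i) U (parKnitY_inv i U) hparK hU hω hb1 hb2 hs Φ
  rw [sub_mul]
  linarith

/-! ## §2 The two-sided `L²` operator bounds of `G′(U; parKnitY)` -/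

/-- `Δ′_a(U; parKnitY)` is symmetric for the trace pairing whenever the knit legs are `G`-valued, `G ≤ U(N)` (no smallness).
[cite: Balaban1985BackgroundPropagators, (3.24) p.394, Thm 3.11 p.416] -/
theorem symm0_parKnitY (hG : G ≤ B7Prop2Explicit.unitaryUnits (Matrix (Fin N) (Fin N) ℂ)) {U : CfgY (Matrix (Fin N) (Fin N) ℂ) i}
    (hU : ∀ μ x, U μ x ∈ G) (hpar : ∀ z w : SiteY i, parKnitY i U z w ∈ G) : IsSymmTr (fun _ => (1 : ℝ)) (deltaPrimeAY i (parKnitY i) U) :=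
  deltaPrimeAY_isSymmTr_of_inv_symm i hG (parKnitY i) U (parKnitY_inv i U) hpar hU

/-- THE UPPER FORM BOUND OF (3.24) AT THE KNIT LETTER: `⟨Φ, Δ′_a(U; parKnitY)Φ⟩₁ ≤ (4(d+1)+1)·⟨Φ, Φ⟩₁` (`G`-valued knit legs, no smallness).
[cite: Balaban1985BackgroundPropagators, (3.23)–(3.24) pp.394–395, Thm 3.11 p.416] -/
theorem trIP_deltaPrimeAY_parKnitY_le (hG : G ≤ B7Prop2Explicit.unitaryUnits (Matrix (Fin N) (Fin N) ℂ)) {U : CfgY (Matrix (Fin N) (Fin N) ℂ) i}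
    (hU : ∀ μ x, U μ x ∈ G) (hpar : ∀ z w : SiteY i, parKnitY i U z w ∈ G) (Φ : SiteY i → Matrix (Fin N) (Fin N) ℂ) :
    trIP (fun _ => (1 : ℝ)) Φ (deltaPrimeAY i (parKnitY i) U Φ) ≤ (4 * ((d : ℝ) + 1) + 1) * trIP (fun _ => (1 : ℝ)) Φ Φ :=
  trIP_deltaPrimeAY_le i hG (parKnitY i) U (parKnitY_inv i U) hpar hU Φ

/-- the coercivity constant of file 6 is positive. [cite: Balaban1985BackgroundPropagators, Thm 3.1 p.397, bookkeeping] -/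
theorem knitCoerciveConst_pos : (0 : ℝ) < (1 / 32 : ℝ) * (((((ℓ + 1) ^ i.k : ℕ) : ℝ)) ^ 2)⁻¹ := by
  positivity

/-- ★★ **«‖G′(U)‖ ≤ 32L^{2k}» AT THE KNIT LETTER, UNIFORMLY ON THE CLASS (3.35) ∩ (52)**: `‖G′(U; parKnitY)Ψ‖²₁ ≤ (32·(L^k)²)²·‖Ψ‖²₁`.
[cite: Balaban1985BackgroundPropagators, Thm 3.1 p.397, (3.25) p.394, Thm 3.11 p.416; Balaban1984PropagatorsII, p.225] -/
theorem trIP_GpY_parKnitY_self_le [Nonempty (Fin N)] (hG : G ≤ B7Prop2Explicit.unitaryUnits (Matrix (Fin N) (Fin N) ℂ))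
    (hGa : AvgClosed (d + 1) (ℓ + 1) G) {U : CfgY (Matrix (Fin N) (Fin N) ℂ) i} {c α₀ : ℝ} (hC0 : 0 ≤ c * (kGeo i).M * α₀)
    (hC1 : c * (kGeo i).M * α₀ * ((d : ℝ) + 1) ≤ 1 / 16) (hreg : (bg9K (Matrix (Fin N) (Fin N) ℂ) G i).Reg335 c α₀ U)
    {α₀' : ℝ} (hα : 0 < α₀') (hα3 : C0 (d + 1) * α₀' ≤ 1 / 3) (hα2 : 2 * α₀' ≤ c2' (d + 1) (ℓ + 1)) (hαd : ((d : ℝ) + 1) ^ 2 * α₀' ≤ 1 / 100)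
    (h52 : pdev (liftCfg U) < α₀' * ((((ℓ + 1 : ℕ) : ℝ) ^ i.k)⁻¹) ^ 2) (Ψ : SiteY i → Matrix (Fin N) (Fin N) ℂ) :
    trIP (fun _ => (1 : ℝ)) (GpY i (parKnitY i) U Ψ) (GpY i (parKnitY i) U Ψ)
      ≤ (32 * ((((ℓ + 1) ^ i.k : ℕ) : ℝ)) ^ 2) ^ 2 * trIP (fun _ => (1 : ℝ)) Ψ Ψ := by
  have h := trIP_ringInverse_self_le (fun _ => one_pos) (knitCoerciveConst_pos i)
    (fun Φ => trIP_deltaPrimeAY_parKnitY_ge i hG hGa hC0 hC1 hreg hα hα3 hα2 hαd h52 Φ) Ψ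
  have hn : (0 : ℝ) < ((((ℓ + 1) ^ i.k : ℕ) : ℝ)) ^ 2 := by positivity
  have e : ((1 / 32 : ℝ) * (((((ℓ + 1) ^ i.k : ℕ) : ℝ)) ^ 2)⁻¹) ^ 2 * ((32 * ((((ℓ + 1) ^ i.k : ℕ) : ℝ)) ^ 2) ^ 2) = 1 := by
    field_simp
  calc trIP (fun _ => (1 : ℝ)) (GpY i (parKnitY i) U Ψ) (GpY i (parKnitY i) U Ψ)
      = ((32 * ((((ℓ + 1) ^ i.k : ℕ) : ℝ)) ^ 2) ^ 2) *
          (((1 / 32 : ℝ) * (((((ℓ + 1) ^ i.k : ℕ) : ℝ)) ^ 2)⁻¹) ^ 2 * trIP (fun _ => (1 : ℝ)) (GpY i (parKnitY i) U Ψ) (GpY i (parKnitY i) U Ψ)) := by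
        rw [← mul_assoc, mul_comm ((32 * _) ^ 2), e, one_mul]
    _ ≤ (32 * ((((ℓ + 1) ^ i.k : ℕ) : ℝ)) ^ 2) ^ 2 * trIP (fun _ => (1 : ℝ)) Ψ Ψ := mul_le_mul_of_nonneg_left h (by positivity)

/-- ★★ **«G′(U) ≤ 32L^{2k}» AS A FORM AT THE KNIT LETTER**: `⟨Ψ, G′(U; parKnitY)Ψ⟩₁ ≤ 32·(L^k)²·‖Ψ‖²₁` on the class.
[cite: Balaban1985BackgroundPropagators, Thm 3.1 p.397, (3.25) p.394] -/
theorem trIP_GpY_parKnitY_le [Nonempty (Fin N)] (hG : G ≤ B7Prop2Explicit.unitaryUnits (Matrix (Fin N) (Fin N) ℂ))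
    (hGa : AvgClosed (d + 1) (ℓ + 1) G) {U : CfgY (Matrix (Fin N) (Fin N) ℂ) i} {c α₀ : ℝ} (hC0 : 0 ≤ c * (kGeo i).M * α₀)
    (hC1 : c * (kGeo i).M * α₀ * ((d : ℝ) + 1) ≤ 1 / 16) (hreg : (bg9K (Matrix (Fin N) (Fin N) ℂ) G i).Reg335 c α₀ U)
    {α₀' : ℝ} (hα : 0 < α₀') (hα3 : C0 (d + 1) * α₀' ≤ 1 / 3) (hα2 : 2 * α₀' ≤ c2' (d + 1) (ℓ + 1)) (hαd : ((d : ℝ) + 1) ^ 2 * α₀' ≤ 1 / 100)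
    (h52 : pdev (liftCfg U) < α₀' * ((((ℓ + 1 : ℕ) : ℝ) ^ i.k)⁻¹) ^ 2) (Ψ : SiteY i → Matrix (Fin N) (Fin N) ℂ) :
    trIP (fun _ => (1 : ℝ)) Ψ (GpY i (parKnitY i) U Ψ) ≤ 32 * ((((ℓ + 1) ^ i.k : ℕ) : ℝ)) ^ 2 * trIP (fun _ => (1 : ℝ)) Ψ Ψ := by
  have h := trIP_ringInverse_le (fun _ => one_pos) (knitCoerciveConst_pos i)
    (fun Φ => trIP_deltaPrimeAY_parKnitY_ge i hG hGa hC0 hC1 hreg hα hα3 hα2 hαd h52 Φ) Ψ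
  have hn : (0 : ℝ) < ((((ℓ + 1) ^ i.k : ℕ) : ℝ)) ^ 2 := by positivity
  have e : (1 / 32 : ℝ) * (((((ℓ + 1) ^ i.k : ℕ) : ℝ)) ^ 2)⁻¹ * (32 * ((((ℓ + 1) ^ i.k : ℕ) : ℝ)) ^ 2) = 1 := by field_simp
  calc trIP (fun _ => (1 : ℝ)) Ψ (GpY i (parKnitY i) U Ψ)
      = (32 * ((((ℓ + 1) ^ i.k : ℕ) : ℝ)) ^ 2) * ((1 / 32 : ℝ) * (((((ℓ + 1) ^ i.k : ℕ) : ℝ)) ^ 2)⁻¹ * trIP (fun _ => (1 : ℝ)) Ψ (GpY i (parKnitY i) U Ψ)) := by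
        rw [← mul_assoc, mul_comm (32 * _), e, one_mul]
    _ ≤ 32 * ((((ℓ + 1) ^ i.k : ℕ) : ℝ)) ^ 2 * trIP (fun _ => (1 : ℝ)) Ψ Ψ := mul_le_mul_of_nonneg_left h (by positivity)

/-- ★ THE COERCIVITY TRANSPORTED TO `G′(U; parKnitY)`: `(1∕32)·(L^k)⁻²·‖G′Ψ‖²₁ ≤ ⟨Ψ, G′Ψ⟩₁` on the class.
[cite: Balaban1985BackgroundPropagators, Thm 3.1 p.397, (3.25) p.394 («positivity of the operators G′»)] -/
theorem trIP_GpY_parKnitY_ge_self [Nonempty (Fin N)] (hG : G ≤ B7Prop2Explicit.unitaryUnits (Matrix (Fin N) (Fin N) ℂ))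
    (hGa : AvgClosed (d + 1) (ℓ + 1) G) {U : CfgY (Matrix (Fin N) (Fin N) ℂ) i} {c α₀ : ℝ} (hC0 : 0 ≤ c * (kGeo i).M * α₀)
    (hC1 : c * (kGeo i).M * α₀ * ((d : ℝ) + 1) ≤ 1 / 16) (hreg : (bg9K (Matrix (Fin N) (Fin N) ℂ) G i).Reg335 c α₀ U)
    {α₀' : ℝ} (hα : 0 < α₀') (hα3 : C0 (d + 1) * α₀' ≤ 1 / 3) (hα2 : 2 * α₀' ≤ c2' (d + 1) (ℓ + 1)) (hαd : ((d : ℝ) + 1) ^ 2 * α₀' ≤ 1 / 100)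
    (h52 : pdev (liftCfg U) < α₀' * ((((ℓ + 1 : ℕ) : ℝ) ^ i.k)⁻¹) ^ 2) (Ψ : SiteY i → Matrix (Fin N) (Fin N) ℂ) :
    (1 / 32 : ℝ) * (((((ℓ + 1) ^ i.k : ℕ) : ℝ)) ^ 2)⁻¹ * trIP (fun _ => (1 : ℝ)) (GpY i (parKnitY i) U Ψ) (GpY i (parKnitY i) U Ψ)
      ≤ trIP (fun _ => (1 : ℝ)) Ψ (GpY i (parKnitY i) U Ψ) :=
  trIP_ringInverse_ge_self (fun _ => one_pos) (knitCoerciveConst_pos i)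
    (fun Φ => trIP_deltaPrimeAY_parKnitY_ge i hG hGa hC0 hC1 hreg hα hα3 hα2 hαd h52 Φ) Ψ

/-- ★ THE LEVEL-WEIGHTED COERCIVITY TRANSPORTED TO `G′(U; parKnitY)`: `(1∕32)·Σ_z (L^{lev z})⁻²·HS((G′Ψ)(z)) ≤ ⟨Ψ, G′Ψ⟩₁` on the class.
[cite: Balaban1985BackgroundPropagators, Thm 3.1 p.397, (3.24) p.394; Balaban1984PropagatorsII, (2.14) p.225] -/
theorem levelMass_GpY_parKnitY_le [Nonempty (Fin N)] (hG : G ≤ B7Prop2Explicit.unitaryUnits (Matrix (Fin N) (Fin N) ℂ))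
    (hGa : AvgClosed (d + 1) (ℓ + 1) G) {U : CfgY (Matrix (Fin N) (Fin N) ℂ) i} {c α₀ : ℝ} (hC0 : 0 ≤ c * (kGeo i).M * α₀)
    (hC1 : c * (kGeo i).M * α₀ * ((d : ℝ) + 1) ≤ 1 / 16) (hreg : (bg9K (Matrix (Fin N) (Fin N) ℂ) G i).Reg335 c α₀ U)
    {α₀' : ℝ} (hα : 0 < α₀') (hα3 : C0 (d + 1) * α₀' ≤ 1 / 3) (hα2 : 2 * α₀' ≤ c2' (d + 1) (ℓ + 1)) (hαd : ((d : ℝ) + 1) ^ 2 * α₀' ≤ 1 / 100)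
    (h52 : pdev (liftCfg U) < α₀' * ((((ℓ + 1 : ℕ) : ℝ) ^ i.k)⁻¹) ^ 2) (Ψ : SiteY i → Matrix (Fin N) (Fin N) ℂ) :
    (1 / 32 : ℝ) * ∑ z : SiteY i, (((((ℓ + 1) ^ (blkOf i.D.toDomains z).1.1 : ℕ) : ℝ)) ^ 2)⁻¹ * ∑ a, ∑ b, ‖GpY i (parKnitY i) U Ψ z a b‖ ^ 2
      ≤ trIP (fun _ => (1 : ℝ)) Ψ (GpY i (parKnitY i) U Ψ) := by
  have hU : ∀ μ x, U μ x ∈ G := hreg.1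
  have hparK : ∀ z w : SiteY i, parKnitY i U z w ∈ G := fun z w => parKnitY_mem_of_pdev i hGa hU hα hα3 hα2 h52 z w
  have hunit : IsUnit (deltaPrimeAY i (parKnitY i) U) := isUnit_deltaPrimeAY_parKnitY i hG hU hparK
  have h := trIP_deltaPrimeAY_parKnitY_ge_levelMass i hG hGa hC0 hC1 hreg hα hα3 hα2 hαd h52 (GpY i (parKnitY i) U Ψ)
  have hGp : GpY i (parKnitY i) U = Ring.inverse (deltaPrimeAY i (parKnitY i) U) := rfl
  rwa [hGp, apply_inverse_of_isUnit hunit, trIP_comm _ _ Ψ] at h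

/-- ★ **«G′(U) ≥ (4(d+1)+1)⁻¹» AT THE KNIT LETTER** for every `G`-valued `U` with `G`-valued knit legs, `G ≤ U(N)` (no smallness):
`‖Ψ‖²₁ ≤ (4(d+1)+1)·⟨Ψ, G′(U; parKnitY)Ψ⟩₁`. [cite: Balaban1985BackgroundPropagators, Thm 3.11 p.416, (3.24)–(3.25) p.394] -/
theorem trIP_self_le_GpY_parKnitY (hG : G ≤ B7Prop2Explicit.unitaryUnits (Matrix (Fin N) (Fin N) ℂ)) {U : CfgY (Matrix (Fin N) (Fin N) ℂ) i}
    (hU : ∀ μ x, U μ x ∈ G) (hpar : ∀ z w : SiteY i, parKnitY i U z w ∈ G) (Ψ : SiteY i → Matrix (Fin N) (Fin N) ℂ) :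
    trIP (fun _ => (1 : ℝ)) Ψ Ψ ≤ (4 * ((d : ℝ) + 1) + 1) * trIP (fun _ => (1 : ℝ)) Ψ (GpY i (parKnitY i) U Ψ) := by
  have hpd := deltaPrimeAY_parKnitY_posDefTr i hG hU hpar
  have hpos : ∀ Φ, 0 ≤ trIP (fun _ => (1 : ℝ)) Φ (deltaPrimeAY i (parKnitY i) U Φ) := by
    intro Φ
    by_cases hΦ : Φ = 0
    · rw [hΦ, map_zero, trIP_zero_right]
    · exact (hpd Φ hΦ).le
  have hd1 : (0 : ℝ) < 4 * ((d : ℝ) + 1) + 1 := by positivity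
  exact trIP_self_le_ringInverse_of_symm (symm0_parKnitY i hG hU hpar) hpos hd1 (trIP_deltaPrimeAY_parKnitY_le i hG hU hpar)
    (isUnit_deltaPrimeAY_parKnitY i hG hU hpar) Ψ

/-! ## §3 Agmon's bound: the `L²`-local decay of `G′(U; parKnitY)` -/

/-- unpacking the constants with a free floor `c ≤ c₀`, `c > 0`: `c₀²m_Am_BW²P_A ≤ Q ⇒ P_A ≤ (c²)⁻¹·(L_A²L_B²∕W²)·Q`.
[cite: Agmon1982, Ch.1, bookkeeping] -/
theorem agmon_unpack_of_le {c c₀ LA LB W PA Q : ℝ} (hc : 0 < c) (hc₀ : c ≤ c₀) (hLA : 0 < LA) (hLB : 0 < LB) (hW : 0 < W) (hQ : 0 ≤ Q)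
    (h : c₀ ^ 2 * (LA ^ 2)⁻¹ * (LB ^ 2)⁻¹ * W ^ 2 * PA ≤ Q) : PA ≤ (c ^ 2)⁻¹ * (LA ^ 2 * LB ^ 2 / W ^ 2) * Q := by
  have hc₀0 : 0 < c₀ := lt_of_lt_of_le hc hc₀
  have e : (c₀ ^ 2)⁻¹ * (LA ^ 2 * LB ^ 2 / W ^ 2) * (c₀ ^ 2 * (LA ^ 2)⁻¹ * (LB ^ 2)⁻¹ * W ^ 2 * PA) = PA := by
    field_simp
  have hkey : PA ≤ (c₀ ^ 2)⁻¹ * (LA ^ 2 * LB ^ 2 / W ^ 2) * Q := by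
    calc PA = (c₀ ^ 2)⁻¹ * (LA ^ 2 * LB ^ 2 / W ^ 2) * (c₀ ^ 2 * (LA ^ 2)⁻¹ * (LB ^ 2)⁻¹ * W ^ 2 * PA) := e.symm
      _ ≤ (c₀ ^ 2)⁻¹ * (LA ^ 2 * LB ^ 2 / W ^ 2) * Q := mul_le_mul_of_nonneg_left h (by positivity)
  have hc2 : (c₀ ^ 2)⁻¹ ≤ (c ^ 2)⁻¹ := inv_anti₀ (by positivity) (pow_le_pow_left₀ hc.le hc₀ 2)
  exact hkey.trans (mul_le_mul_of_nonneg_right (mul_le_mul_of_nonneg_right hc2 (by positivity)) hQ)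

/-- at `Φ = G′(U; parKnitY)Ψ` with `Ψ` supported where `ω = 1`, THE CONJUGATED FORM OF `ωΦ` IS THE PLAIN PAIRING:
`⟨ω(ωΦ), Δ′_a(U; parKnitY)(ω⁻¹(ωΦ))⟩₁ = ⟨Φ, Ψ⟩₁` (`G`-valued `U` and knit legs, `G ≤ U(N)`; no smallness).
[cite: Agmon1982, Ch.1; Balaban1985BackgroundPropagators, (3.25) p.394] -/
theorem conj_wsmul_GpY_parKnitY_eq_pairing (hG : G ≤ B7Prop2Explicit.unitaryUnits (Matrix (Fin N) (Fin N) ℂ)) {U : CfgY (Matrix (Fin N) (Fin N) ℂ) i}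
    (hU : ∀ μ x, U μ x ∈ G) (hpar : ∀ z w : SiteY i, parKnitY i U z w ∈ G) {ω : SiteY i → ℝ} (hω : ∀ z, 0 < ω z) {B : Finset (SiteY i)}
    {Ψ : SiteY i → Matrix (Fin N) (Fin N) ℂ} (hΨ : ∀ z, z ∉ B → Ψ z = 0) (hωB : ∀ z ∈ B, ω z = 1) :
    trIP (fun _ => (1 : ℝ)) (fun z => ((ω z : ℝ) : ℂ) • (((ω z : ℝ) : ℂ) • GpY i (parKnitY i) U Ψ z))
        (deltaPrimeAY i (parKnitY i) U (fun z => (((ω z)⁻¹ : ℝ) : ℂ) • (((ω z : ℝ) : ℂ) • GpY i (parKnitY i) U Ψ z)))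
      = trIP (fun _ => (1 : ℝ)) (GpY i (parKnitY i) U Ψ) Ψ := by
  have hunit : IsUnit (deltaPrimeAY i (parKnitY i) U) := isUnit_deltaPrimeAY_parKnitY i hG hU hpar
  have hinvΦ : (fun z => (((ω z)⁻¹ : ℝ) : ℂ) • (((ω z : ℝ) : ℂ) • GpY i (parKnitY i) U Ψ z)) = GpY i (parKnitY i) U Ψ := by
    funext z
    rw [smul_smul, ← Complex.ofReal_mul, inv_mul_cancel₀ (hω z).ne', Complex.ofReal_one, one_smul]
  have hΔΦ : deltaPrimeAY i (parKnitY i) U (GpY i (parKnitY i) U Ψ) = Ψ := apply_inverse_of_isUnit hunit Ψ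
  rw [hinvΦ, hΔΦ, trIP_wsq_eq_of_support i hωB hΨ]

/-- ★★ **AGMON'S FIRST READING AT THE KNIT LETTER**: on the class, for `Ψ` vanishing off `B`, a weight `ω > 0` with `ω = 1` on `B` meeting the bond∕block
hypotheses, and `Φ := G′(U; parKnitY)Ψ`: `(1∕32 − (d+1)θ_b − θ_s∕2)·Σ_z m_z·HS(ω_z·Φ z) ≤ ⟨Φ, Ψ⟩₁`.
[cite: Agmon1982, Ch.1, Thm 1.5; Balaban1985BackgroundPropagators, Thm 3.1 (3.46) p.398, (3.19) p.393] -/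
theorem levelMass_wsmul_GpY_parKnitY_le_pairing [Nonempty (Fin N)] (hG : G ≤ B7Prop2Explicit.unitaryUnits (Matrix (Fin N) (Fin N) ℂ))
    (hGa : AvgClosed (d + 1) (ℓ + 1) G) {U : CfgY (Matrix (Fin N) (Fin N) ℂ) i} {c α₀ : ℝ} (hC0 : 0 ≤ c * (kGeo i).M * α₀)
    (hC1 : c * (kGeo i).M * α₀ * ((d : ℝ) + 1) ≤ 1 / 16) (hreg : (bg9K (Matrix (Fin N) (Fin N) ℂ) G i).Reg335 c α₀ U)
    {α₀' : ℝ} (hα : 0 < α₀') (hα3 : C0 (d + 1) * α₀' ≤ 1 / 3) (hα2 : 2 * α₀' ≤ c2' (d + 1) (ℓ + 1)) (hαd : ((d : ℝ) + 1) ^ 2 * α₀' ≤ 1 / 100)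
    (h52 : pdev (liftCfg U) < α₀' * ((((ℓ + 1 : ℕ) : ℝ) ^ i.k)⁻¹) ^ 2) {ω : SiteY i → ℝ} (hω : ∀ z, 0 < ω z) {θb θs : ℝ}
    (hb1 : ∀ μ z, ω (shiftY i μ z) / ω z + ω z / ω (shiftY i μ z) - 2 ≤ θb * (((((ℓ + 1) ^ (blkOf i.D.toDomains z).1.1 : ℕ) : ℝ)) ^ 2)⁻¹)
    (hb2 : ∀ μ z, ω (shiftY i μ z) / ω z + ω z / ω (shiftY i μ z) - 2 ≤ θb * (((((ℓ + 1) ^ (blkOf i.D.toDomains (shiftY i μ z)).1.1 : ℕ) : ℝ)) ^ 2)⁻¹)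
    (hs : ∀ z w : SiteY i, blkOf i.D.toDomains w = blkOf i.D.toDomains z → ω z / ω w + ω w / ω z - 2 ≤ θs)
    {B : Finset (SiteY i)} {Ψ : SiteY i → Matrix (Fin N) (Fin N) ℂ} (hΨ : ∀ z, z ∉ B → Ψ z = 0) (hωB : ∀ z ∈ B, ω z = 1) :
    (1 / 32 - (((d : ℝ) + 1) * θb + θs / 2)) *
        ∑ z : SiteY i, (((((ℓ + 1) ^ (blkOf i.D.toDomains z).1.1 : ℕ) : ℝ)) ^ 2)⁻¹ * ∑ a, ∑ b, ‖(((ω z : ℝ) : ℂ) • GpY i (parKnitY i) U Ψ z) a b‖ ^ 2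
      ≤ trIP (fun _ => (1 : ℝ)) (GpY i (parKnitY i) U Ψ) Ψ := by
  have hU : ∀ μ x, U μ x ∈ G := hreg.1
  have hparK : ∀ z w : SiteY i, parKnitY i U z w ∈ G := fun z w => parKnitY_mem_of_pdev i hGa hU hα hα3 hα2 h52 z w
  have hconj := trIP_wsmul_deltaPrimeAY_parKnitY_winv_ge_levelMass i hG hGa hC0 hC1 hreg hα hα3 hα2 hαd h52 hω hb1 hb2 hs
    (fun z => ((ω z : ℝ) : ℂ) • GpY i (parKnitY i) U Ψ z)
  rwa [conj_wsmul_GpY_parKnitY_eq_pairing i hG hU hparK hω hΨ hωB] at hconj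

/-- ★★ **AGMON'S SECOND READING AT THE KNIT LETTER**: under the same hypotheses, `(d+1)θ_b + θ_s∕2 ≤ 1∕64` and levels `≤ j_B` on `B`:
`(1∕32 − (d+1)θ_b − θ_s∕2)·(L^{j_B})⁻²·⟨G′(U; parKnitY)Ψ, Ψ⟩₁ ≤ ‖Ψ‖²₁`.
[cite: Agmon1982, Ch.1, Thm 1.5; Balaban1985BackgroundPropagators, Thm 3.1 (3.46) p.398, (3.19) p.393] -/
theorem pairing_GpY_parKnitY_le_of_support [Nonempty (Fin N)] (hG : G ≤ B7Prop2Explicit.unitaryUnits (Matrix (Fin N) (Fin N) ℂ))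
    (hGa : AvgClosed (d + 1) (ℓ + 1) G) {U : CfgY (Matrix (Fin N) (Fin N) ℂ) i} {c α₀ : ℝ} (hC0 : 0 ≤ c * (kGeo i).M * α₀)
    (hC1 : c * (kGeo i).M * α₀ * ((d : ℝ) + 1) ≤ 1 / 16) (hreg : (bg9K (Matrix (Fin N) (Fin N) ℂ) G i).Reg335 c α₀ U)
    {α₀' : ℝ} (hα : 0 < α₀') (hα3 : C0 (d + 1) * α₀' ≤ 1 / 3) (hα2 : 2 * α₀' ≤ c2' (d + 1) (ℓ + 1)) (hαd : ((d : ℝ) + 1) ^ 2 * α₀' ≤ 1 / 100)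
    (h52 : pdev (liftCfg U) < α₀' * ((((ℓ + 1 : ℕ) : ℝ) ^ i.k)⁻¹) ^ 2) {ω : SiteY i → ℝ} (hω : ∀ z, 0 < ω z) {θb θs : ℝ}
    (hb1 : ∀ μ z, ω (shiftY i μ z) / ω z + ω z / ω (shiftY i μ z) - 2 ≤ θb * (((((ℓ + 1) ^ (blkOf i.D.toDomains z).1.1 : ℕ) : ℝ)) ^ 2)⁻¹)
    (hb2 : ∀ μ z, ω (shiftY i μ z) / ω z + ω z / ω (shiftY i μ z) - 2 ≤ θb * (((((ℓ + 1) ^ (blkOf i.D.toDomains (shiftY i μ z)).1.1 : ℕ) : ℝ)) ^ 2)⁻¹)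
    (hs : ∀ z w : SiteY i, blkOf i.D.toDomains w = blkOf i.D.toDomains z → ω z / ω w + ω w / ω z - 2 ≤ θs)
    (hκ : ((d : ℝ) + 1) * θb + θs / 2 ≤ 1 / 64)
    {B : Finset (SiteY i)} {Ψ : SiteY i → Matrix (Fin N) (Fin N) ℂ} (hΨ : ∀ z, z ∉ B → Ψ z = 0) (hωB : ∀ z ∈ B, ω z = 1)
    {jB : ℕ} (hjB : ∀ z ∈ B, (blkOf i.D.toDomains z).1.1 ≤ jB) :
    (1 / 32 - (((d : ℝ) + 1) * θb + θs / 2)) * (((((ℓ + 1) ^ jB : ℕ) : ℝ)) ^ 2)⁻¹ * trIP (fun _ => (1 : ℝ)) (GpY i (parKnitY i) U Ψ) Ψ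
      ≤ trIP (fun _ => (1 : ℝ)) Ψ Ψ := by
  have hc₀0 : 0 < 1 / 32 - (((d : ℝ) + 1) * θb + θs / 2) := by linarith
  have hiX := levelMass_wsmul_GpY_parKnitY_le_pairing i hG hGa hC0 hC1 hreg hα hα3 hα2 hαd h52 hω hb1 hb2 hs hΨ hωB
  have hPB0 : 0 ≤ ∑ z ∈ B, ∑ a, ∑ b, ‖GpY i (parKnitY i) U Ψ z a b‖ ^ 2 := Finset.sum_nonneg fun _ _ => hs_nonneg _
  have hQ0 : 0 ≤ trIP (fun _ => (1 : ℝ)) Ψ Ψ := trIP_self_nonneg _ (fun _ => one_pos) Ψ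
  have hX2 : trIP (fun _ => (1 : ℝ)) (GpY i (parKnitY i) U Ψ) Ψ ^ 2
      ≤ (∑ z ∈ B, ∑ a, ∑ b, ‖GpY i (parKnitY i) U Ψ z a b‖ ^ 2) * trIP (fun _ => (1 : ℝ)) Ψ Ψ := by
    have h := abs_trIP_le_of_support i hΨ (GpY i (parKnitY i) U Ψ)
    calc trIP (fun _ => (1 : ℝ)) (GpY i (parKnitY i) U Ψ) Ψ ^ 2 = |trIP (fun _ => (1 : ℝ)) (GpY i (parKnitY i) U Ψ) Ψ| ^ 2 := (sq_abs _).symm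
      _ ≤ (Real.sqrt (∑ z ∈ B, ∑ a, ∑ b, ‖GpY i (parKnitY i) U Ψ z a b‖ ^ 2) * Real.sqrt (trIP (fun _ => (1 : ℝ)) Ψ Ψ)) ^ 2 :=
          pow_le_pow_left₀ (abs_nonneg _) h 2
      _ = _ := by rw [mul_pow, Real.sq_sqrt hPB0, Real.sq_sqrt hQ0]
  have hMB := sum_filter_hs_le_levelMass i ω hjB zero_le_one (fun z hz => (hωB z hz).ge) (GpY i (parKnitY i) U Ψ)
  rw [one_pow, mul_one] at hMB
  exact agmon_arith_pairing hc₀0 (inv_pos.2 (by positivity)) hPB0 hQ0 hiX hX2 hMB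

/-- ★★★ **THE `L²`-LOCAL DECAY OF `G′(U; parKnitY)` ON THE CLASS (3.35) ∩ (52) — (3.46a)'s SHAPE AT PRINT'S OWN TRANSPORTERS, BY AGMON'S METHOD.**
ON THE CLASS; finite site sets `A`, `B`; `Ψ` vanishing off `B`; a weight `ω > 0` with `ω = 1` on `B`, `ω ≥ W > 0` on `A`, bond ratios
`q(ω(z+e_μ), ω z) ≤ θ_b·(L^{lev})⁻²` (both ends), block oscillation `q ≤ θ_s`, `(d+1)θ_b + θ_s∕2 ≤ 1∕64`; levels `≤ j_A` on `A`, `≤ j_B` on `B`.  THEN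
`Σ_{z∈A} HS((G′(U; parKnitY)Ψ)(z)) ≤ 4096·((L^{j_A})²(L^{j_B})²∕W²)·‖Ψ‖²₁` — i.e. `‖1_A G′ 1_B‖ ≤ 64·L^{j_A}L^{j_B}·W⁻¹`, print's `B₀(Lʲη)(Lʲ′η)e^{−δ₀d(y,y′)}`
with `B₀ = 64` once `W = e^{δ₀d}`, member-∕volume-∕k-∕N-∕U-uniformly.
[cite: Balaban1985BackgroundPropagators, Thm 3.1 (3.46) p.398, (3.19) p.393, (3.35) p.396; Agmon1982, Ch.1, Thm 1.5; Balaban1985Averaging, (52)–(53) pp.26–27] -/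
theorem hs_restrict_GpY_parKnitY_le [Nonempty (Fin N)] (hG : G ≤ B7Prop2Explicit.unitaryUnits (Matrix (Fin N) (Fin N) ℂ))
    (hGa : AvgClosed (d + 1) (ℓ + 1) G) {U : CfgY (Matrix (Fin N) (Fin N) ℂ) i} {c α₀ : ℝ} (hC0 : 0 ≤ c * (kGeo i).M * α₀)
    (hC1 : c * (kGeo i).M * α₀ * ((d : ℝ) + 1) ≤ 1 / 16) (hreg : (bg9K (Matrix (Fin N) (Fin N) ℂ) G i).Reg335 c α₀ U)
    {α₀' : ℝ} (hα : 0 < α₀') (hα3 : C0 (d + 1) * α₀' ≤ 1 / 3) (hα2 : 2 * α₀' ≤ c2' (d + 1) (ℓ + 1)) (hαd : ((d : ℝ) + 1) ^ 2 * α₀' ≤ 1 / 100)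
    (h52 : pdev (liftCfg U) < α₀' * ((((ℓ + 1 : ℕ) : ℝ) ^ i.k)⁻¹) ^ 2) {ω : SiteY i → ℝ} (hω : ∀ z, 0 < ω z) {θb θs : ℝ}
    (hb1 : ∀ μ z, ω (shiftY i μ z) / ω z + ω z / ω (shiftY i μ z) - 2 ≤ θb * (((((ℓ + 1) ^ (blkOf i.D.toDomains z).1.1 : ℕ) : ℝ)) ^ 2)⁻¹)
    (hb2 : ∀ μ z, ω (shiftY i μ z) / ω z + ω z / ω (shiftY i μ z) - 2 ≤ θb * (((((ℓ + 1) ^ (blkOf i.D.toDomains (shiftY i μ z)).1.1 : ℕ) : ℝ)) ^ 2)⁻¹)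
    (hs : ∀ z w : SiteY i, blkOf i.D.toDomains w = blkOf i.D.toDomains z → ω z / ω w + ω w / ω z - 2 ≤ θs)
    (hκ : ((d : ℝ) + 1) * θb + θs / 2 ≤ 1 / 64)
    {A B : Finset (SiteY i)} {Ψ : SiteY i → Matrix (Fin N) (Fin N) ℂ} (hΨ : ∀ z, z ∉ B → Ψ z = 0) (hωB : ∀ z ∈ B, ω z = 1)
    {jA jB : ℕ} (hjA : ∀ z ∈ A, (blkOf i.D.toDomains z).1.1 ≤ jA) (hjB : ∀ z ∈ B, (blkOf i.D.toDomains z).1.1 ≤ jB)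
    {W : ℝ} (hW0 : 0 < W) (hW : ∀ z ∈ A, W ≤ ω z) :
    ∑ z ∈ A, ∑ a, ∑ b, ‖GpY i (parKnitY i) U Ψ z a b‖ ^ 2
      ≤ 4096 * (((((ℓ + 1) ^ jA : ℕ) : ℝ)) ^ 2 * ((((ℓ + 1) ^ jB : ℕ) : ℝ)) ^ 2 / W ^ 2) * trIP (fun _ => (1 : ℝ)) Ψ Ψ := by
  have hc₀pos : 1 / 64 ≤ 1 / 32 - (((d : ℝ) + 1) * θb + θs / 2) := by linarith
  have hc₀0 : 0 < 1 / 32 - (((d : ℝ) + 1) * θb + θs / 2) := lt_of_lt_of_le (by norm_num) hc₀pos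
  have hiX := levelMass_wsmul_GpY_parKnitY_le_pairing i hG hGa hC0 hC1 hreg hα hα3 hα2 hαd h52 hω hb1 hb2 hs hΨ hωB
  have hPB0 : 0 ≤ ∑ z ∈ B, ∑ a, ∑ b, ‖GpY i (parKnitY i) U Ψ z a b‖ ^ 2 := Finset.sum_nonneg fun _ _ => hs_nonneg _
  have hQ0 : 0 ≤ trIP (fun _ => (1 : ℝ)) Ψ Ψ := trIP_self_nonneg _ (fun _ => one_pos) Ψ
  have hX2 : trIP (fun _ => (1 : ℝ)) (GpY i (parKnitY i) U Ψ) Ψ ^ 2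
      ≤ (∑ z ∈ B, ∑ a, ∑ b, ‖GpY i (parKnitY i) U Ψ z a b‖ ^ 2) * trIP (fun _ => (1 : ℝ)) Ψ Ψ := by
    have h := abs_trIP_le_of_support i hΨ (GpY i (parKnitY i) U Ψ)
    calc trIP (fun _ => (1 : ℝ)) (GpY i (parKnitY i) U Ψ) Ψ ^ 2 = |trIP (fun _ => (1 : ℝ)) (GpY i (parKnitY i) U Ψ) Ψ| ^ 2 := (sq_abs _).symm
      _ ≤ (Real.sqrt (∑ z ∈ B, ∑ a, ∑ b, ‖GpY i (parKnitY i) U Ψ z a b‖ ^ 2) * Real.sqrt (trIP (fun _ => (1 : ℝ)) Ψ Ψ)) ^ 2 :=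
          pow_le_pow_left₀ (abs_nonneg _) h 2
      _ = _ := by rw [mul_pow, Real.sq_sqrt hPB0, Real.sq_sqrt hQ0]
  have hMB := sum_filter_hs_le_levelMass i ω hjB zero_le_one (fun z hz => (hωB z hz).ge) (GpY i (parKnitY i) U Ψ)
  rw [one_pow, mul_one] at hMB
  have hMA := sum_filter_hs_le_levelMass i ω hjA hW0.le hW (GpY i (parKnitY i) U Ψ)
  have hfin := agmon_arith hc₀0 (inv_pos.2 (by positivity)) hPB0 hQ0 hiX hX2 hMB hMA
  have h64 := agmon_unpack_of_le (by norm_num : (0 : ℝ) < 1 / 64) hc₀pos (by positivity) (by positivity) hW0 hQ0 hfin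
  rwa [show (((1 / 64 : ℝ)) ^ 2)⁻¹ = 4096 by norm_num] at h64

end Literature.MathematicalPhysics.QuantumFieldTheory.Balaban1983to89.B9B8KnitLetterGpDecay

end
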